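import Summits.Ventures.DiscreteObjects.UnitDistance.TwoPlaceZMod11Data
import HarnessLib

/-!
# `unitCircleGraph (ZMod 11 × ZMod 11)` is not 4-colourable — kernel search, piece 2 of 2 (sub-searches below `t121Q3, t121Q5, t121Q6, t121Q8`)

Framing (verbatim for the cell): lottery ticket; floor = certified bounds/negative ranges.

Each state `t121Qi` of `TwoPlaceZMod11Data.lean` is refuted by the bit-vector colouring search of `KernelColouringSearch.lean`
(`decide +kernel`, one evaluation per state: 157, 127, 15, 428 branch nodes), and `t121_pieceI` packages the logical
statement used by `TwoPlaceZMod11.lean`: no proper 4-colouring is consistent with `t121Qi`.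
-/

namespace Summit.Ventures.DiscreteObjects.UnitDistance

open KBits

set_option maxHeartbeats 400000000 in
set_option maxRecDepth 200000 in
/-- KERNEL FACT: the search refutes every 4-colouring below `t121Q3`. -/
theorem t121Q3_run : search t121nb 425 200 [] 425 t121Q3 = true := by
  decide +kernel

/-- PIECE: no proper 4-colouring (for the neighbourhood words `t121nb`) is consistent with the state `t121Q3`. -/
theorem t121_piece3 {col : ℕ → ℕ} (hP : Proper t121nb 425 col) :
    UBound 425 t121Q3 → Cons 425 col t121Q3 → False :=
  search_sound hP (done := []) (by simp) 425 _ t121Q3_run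

set_option maxHeartbeats 400000000 in
set_option maxRecDepth 200000 in
/-- KERNEL FACT: the search refutes every 4-colouring below `t121Q5`. -/
theorem t121Q5_run : search t121nb 425 200 [] 425 t121Q5 = true := by
  decide +kernel

/-- PIECE: no proper 4-colouring (for the neighbourhood words `t121nb`) is consistent with the state `t121Q5`. -/
theorem t121_piece5 {col : ℕ → ℕ} (hP : Proper t121nb 425 col) :
    UBound 425 t121Q5 → Cons 425 col t121Q5 → False :=
  search_sound hP (done := []) (by simp) 425 _ t121Q5_run

set_option maxHeartbeats 400000000 in
set_option maxRecDepth 200000 in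
/-- KERNEL FACT: the search refutes every 4-colouring below `t121Q6`. -/
theorem t121Q6_run : search t121nb 425 200 [] 425 t121Q6 = true := by
  decide +kernel

/-- PIECE: no proper 4-colouring (for the neighbourhood words `t121nb`) is consistent with the state `t121Q6`. -/
theorem t121_piece6 {col : ℕ → ℕ} (hP : Proper t121nb 425 col) :
    UBound 425 t121Q6 → Cons 425 col t121Q6 → False :=
  search_sound hP (done := []) (by simp) 425 _ t121Q6_run

set_option maxHeartbeats 400000000 in
set_option maxRecDepth 200000 in
/-- KERNEL FACT: the search refutes every 4-colouring below `t121Q8`. -/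
theorem t121Q8_run : search t121nb 425 200 [] 425 t121Q8 = true := by
  decide +kernel

/-- PIECE: no proper 4-colouring (for the neighbourhood words `t121nb`) is consistent with the state `t121Q8`. -/
theorem t121_piece8 {col : ℕ → ℕ} (hP : Proper t121nb 425 col) :
    UBound 425 t121Q8 → Cons 425 col t121Q8 → False :=
  search_sound hP (done := []) (by simp) 425 _ t121Q8_run

end Summit.Ventures.DiscreteObjects.UnitDistance
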